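import Mathlib
import HarnessLib
import HarnessLib.Audit
import Summits.KontsevichZagierPeriods.Statement
import Literature.NumberTheory.Transcendental.AyoubPeriodSeries
import Summits.KontsevichZagierPeriods.KontsevichZagierPeriods.Theorems.EulerFormChainBallCalibration
import HarnessLib.Audit.Status.Attr

/-!
Route: SphericalSchlafli

# Route SphericalSchlafli — Schläfli in the family — the spherical volume sector of Conjecture 1
(Coxeter tilings provable, the Kolpakov–Robins π²/162 pair as target)

It suffices to show X = VOLUME FORM of Conjecture 1: two integral representations with integrand 1
(two ℚ-semialgebraic
sets of finite volume, any common dimension N) with equal value are KZ-equivalent — summit ⟹ X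
because integrand 1 is
rational (checked in Sketch.lean), X ⟹ summit by Viu-Sos' difference-of-volumes inside the rules
(Assembly). This route
(card spherical-dehn-zero-schlafli-family) attacks X on its first curved sector: N = 4, domains =
finite unions of
polyhedral-cone sectors of the unit ball B⁴, i.e. SPHERICAL POLYTOPES read radially (vol₄ = Vol₃/4),
where X says "volume is
the only KZ-invariant of spherical polytopes" (crux SphericalVolumeSector) although spherical
scissors congruence has the
Dehn obstruction and an open kernel problem. Deliverables: the Coxeter chamber tilings |W|·[D_T] ∼
[B⁴] (support, provable),
the Kolpakov–Robins chain 648·[D_T] ∼ [π]·[π] for their non-Coxeter-decomposable rational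
tetrahedron T of volume π²/162 by
Schläfli's differential formula run INSIDE the rules along KR's Pythagorean family 11 (crux 2), and
[D_T] ∼ [D_T′] for the
Dehn-zero pair (T, T′ = I₂(9)×I₂(9)) whose scissors congruence is KR's open Question 3.1 (crux 4).
Lean: `∀ ⦃N : ℕ⦄ (r r' : Literature.NumberTheory.Transcendental.KZ.IntegralRep N), (∀ x ∈ r.domain,
r.integrand x = 1) → (∀ x ∈ r'.domain, r'.integrand x = 1) → r.value = r'.value →
Literature.NumberTheory.Transcendental.KZ.Equivalent r r'`

## Assembly
X → summit inside the tree (≈ 400 lines over KZCalculusProofs.lean, shared in substance with route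
ScissorsTransport's
assembly minus its transport step): given rational r (dim n), r′ (dim m) of equal value, split each
domain by the sign of
the integrand (1a; Tarski–Seidenberg proved) and pass to the closed subgraph bands U± , V± with
integrand 1 (one
Newton–Leibniz move each, primitive t; Viu-Sos' difference of volumes), so [r] ≡ [U₊] − [U₋], [r′] ≡
[V₊] − [V₋]; pad all
four to a common dimension by slabs (IntegralRep.slab, equivalent_slab), glue A := U₊ ⊔ V₋, B := V₊
⊔ U₋ at disjoint levels
(IntegralRep.glue, of_glue_sub_sub_mem_domainAddRel); soundness (relations_le_ker_eval_holds) and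
r.value = r′.value give
value A = value B; X gives [A] ∼ [B]; unglue. The ranked cruxes are X's spherical sector and do not
enter this implication.

Rationale: WHY THIS LINE. A spherical tetrahedron T ⊂ S³ with real-algebraic facet normals is, radially, the
integrand-1 representation
[cone(T) ∩ B⁴, 1] of value Vol₃(T)/4, and orthogonal maps with algebraic entries are single
instances of rule 2; so the
finite reflection groups make every Coxeter tetrahedron an accessible identity |W|·[D_T] ∼ [B⁴]
(Coxeter1934), and
Conjecture 1 further predicts chains between ALL equal-volume spherical polytopes, Dehn invariant
notwithstanding
(DupontSah1982) — the calculus is predicted to be strictly stronger than spherical scissors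
congruence. The one place where
this prediction is checkable today without any transcendence input is Kolpakov–Robins' family of
rational ℤ₂-symmetric
tetrahedra (KolpakovRobins2019, arXiv:1811.06598, Prop. 2.1–2.2 after
KolpakovMednykhPashkevich2011/2013): on the
Pythagorean locus cos a + cos b + cos c + cos d = 0 the edge lengths are AFFINE in the dihedral
angles, so Schläfli's
dVol = ½ Σ ℓ_e dθ_e (Milnor, *The Schläfli differential equality*; restated in Zhang2017 §4)
integrates to a quadratic polynomial in angles, and — read as moves —
becomes: one rule-2 map normalising the moving sector cone(T(t)) ∩ B⁴ to a fixed sector with a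
t-dependent algebraic
integrand, ONE rule-3 move in the parameter direction from the degenerate member (family 11:
(p,q,r,s)(t) = (π/4+t/2, π/4−t/2, 2π/3+t, 2π/3−t), Vol(t) = π²/144 − t²/4, admissible on [0,π/6),
Gram rank 2 and Vol = 0
at t = π/6, T at t = π/18 — reconstructed from KR §3 and checked numerically here), fibre Stokes
turning the t-derivative
into facet fluxes = 2-dim "edge-sector" representations ∫∫ ℓ_e dθ_e, and, because dℓ_e = ±dθ_e, a
symmetry move pairing
each into a SQUARE of a rational angle, which Möbius rotation tilings reduce to m²n²-multiples of a
unit square and hence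
to [π]·[π] (support RationalAngleSquares). Imported areas: spherical geometry and scissors
congruence (Coxeter groups,
Schläfli, Dupont–Sah, Cheeger–Simons' rational simplex problem as the frontier), real algebraic
geometry (the tree's
PROVED tarski_seidenberg_real_holds makes algebraic-coefficient cones ℚ-semialgebraic). No prior
route touches curvature
+1: LowDimension is d ≤ 1, ScissorsTransport is the curvature-free transport form, the hyperbolic
cards are the "−"-part
resting on Borel; here every value lies in ℚπ² and the negatives index is empty.

RANKED CRUXES. #0 VolumeForm (target) — X — two integrand-1 integral representations of one
dimension N with equal value are KZ-equivalent (volume is the only KZ-invariant of finite-volume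
ℚ-semialgebraic sets); summit-equivalent frame of the route, attacked here on the spherical sector.
(why it might fail: Summit-equivalent (Assembly; integrand 1 is rational), so every strength barrier
applies: false iff an additive invariant of the four move sets refines volume on ℚ-semialgebraic
sets.) [KontsevichZagier2001, ViuSos2021, CressonViusos2022]
#2 KolpakovRobinsChain (crux) — For the Kolpakov–Robins tetrahedron T — ℤ₂-symmetric, dihedral
angles (p,q,r,s) = (5π/18, 2π/9, 13π/18, 11π/18) in the pattern of their Gram matrix (4) (G_ij =
−cos θ_ij for inward unit normals), volume π²/162, not decomposable into Coxeter tetrahedra (KR Thm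
1.5) — every integrand-1 representation r whose domain is the solid sector {v ∈ B⁴ : ⟨n_i, v⟩ ≥ 0}
for normals n with n nᵀ = G(T) (value π²/648, Monte-Carlo-checked 1/324 of B⁴) satisfies 648·[r] −
[π]·[π] ∈ KZ.relations ([π]·[π] written as the bidisc representation [{v₀²+v₁² ≤ 1, v₂²+v₃² ≤ 1}, 1]
⊂ ℝ⁴, value π²). Intended proof: Schläfli inside the rules along family 11 from the degenerate
member t = π/6 (value 0, null domain ⇒ relation) to t = π/18, then RationalAngleSquares (card items
S2 (i)–(iv)). [deps: RationalAngleSquares, KRSectorExists] [difficulty: L] (why it might fail: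
Anchor t=π/6 is a corank-2 degeneration (Gram rank 2): after the rule-2 map normalising
cone(T(t))∩B⁴ to a fixed sector, ∂ₜ of the transported integrand may fail absolute integrability
there; and the chain may only deliver k·(648[D_T]−[π²]) ∈ relations (division is not a move).)
[KolpakovRobins2019, KolpakovMednykhPashkevich2011, KolpakovMednykhPashkevich2013, Zhang2017,
KontsevichZagier2001]
#3 SphericalVolumeSector (crux) — X on the spherical sector: two integrand-1 representations in
dimension 4 whose domains are finite unions of closed polyhedral-cone sectors {v : ⟨n_i, v⟩ ≥ 0, i <
4} of the closed unit ball B⁴ (spherical polytopes read radially; algebraicity of the normals is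
forced by ℚ-semialgebraicity of the domain) and whose values agree are KZ-equivalent — "volume is
the only KZ-invariant of spherical polytopes": Hilbert's third problem in S³ inside the calculus,
where the Dehn invariant is NO obstruction. Contains every Coxeter tiling, every equal-volume pair
among KR's 59 sporadic + 42 families of rational tetrahedra, the Lambert-cube pairs of KR Questions
4.2/4.3, KR Question 5.1 at n = 3, and Dehn-nonzero equal-volume pairs. [deps: KolpakovRobinsChain]
[difficulty: open-problem] (why it might fail: Only Conjecture 1 predicts it: off the Pythagorean
families equal volumes are coincidences among Re Li₂-combinations (Murakami–Yano type formulas) with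
no chain-producing mechanism, and an additive move-invariant refining volume (e.g. from the
Cheeger–Simons class) would refute it and the summit.) [KolpakovRobins2019, DupontSah1982,
CheegerSimons1985, Goncharov1999, KontsevichZagier2001]
#4 KolpakovRobinsPair (crux) — The Kolpakov–Robins pair is KZ-equivalent: [cone(T) ∩ B⁴, 1] ∼
[cone(T′) ∩ B⁴, 1] for T as in crux 2 and T′ the Coxeter tetrahedron I₂(9)×I₂(9) (dihedral angles
π/9, π/9, π/2, π/2, π/2, π/2; |W| = 324; explicit chamber 0 ≤ θ₁ ≤ π/9, 0 ≤ θ₂ ≤ π/9 in the two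
coordinate planes) — equal volumes π²/162, equal (zero) Dehn invariants, scissors congruence unknown
(KR Question 3.1, also 5.1 at n = 3): the headline "rules ⊋ spherical scissors congruence" instance.
[deps: KolpakovRobinsChain, CoxeterChamberTiling, BallCalibration] [difficulty: L] (why it might
fail: Cruxes 2 + CoxeterChamberTiling + BallCalibration give only 648·([D_T]−[D_T′]) ∈ relations;
concluding needs torsion-freeness of FormalRep⧸relations (open, cf. KZ.PiCancellation) or a
division-free direct splice of the family chain with the I₂(9)² tiling.) [KolpakovRobins2019,
Coxeter1934, DupontSah1982]
#9 CoxeterChamberTiling (support) — 324·[D_T′] − [B⁴] ∈ relations for the I₂(9)×I₂(9) chamber sector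
D_T′ = {v ∈ B⁴ : 0 ≤ θ(v₀,v₁) ≤ π/9, 0 ≤ θ(v₂,v₃) ≤ π/9}: its 324 images under I₂(9)×I₂(9) ⊂
O(2)×O(2) (entries ±cos(kπ/9), ±sin(kπ/9), algebraic, |det| = 1 ⇒ one rule-2 move each; images
ℚ-semialgebraic via tarski_seidenberg_real_holds) cover B⁴ with null overlaps (323 rule-1a moves).
Calibration S1 of the card; the other ten Coxeter tetrahedra are prover-level variants. [difficulty:
M] [Coxeter1934, KolpakovRobins2019]
#9 BallCalibration (support) — 2·[B⁴] − [π]·[π] ∈ relations (vol₄ B⁴ = π²/2; [π]·[π] = the bidisc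
[D²×D², 1] ⊂ ℝ⁴ (value π², = KZ.piRep.prod KZ.piRep up to the definitional integrand)): the
fibrewise scaling (u,w) ↦ (u, √(1−|u|²)·w) maps D²×D² onto B⁴ with Jacobian 1−|u|² (rule 2 on the
open part, null boundary by 1a), integrand additivity splits 1−|u|², and [D²×D², |u|²] ∼ [half-disc
sector form] by the radial-squaring/half-angle map u ↦ |u|·(half-angle of u) (rule 2, Jacobian
|u|²·const) plus a rotation; no division needed. [difficulty: M] [KontsevichZagier2001]
#9 RationalAngleSquares (support) — Squares of rational angles are accessible multiples of [π]·[π]: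
for 0 < m < n the square [0, tan(mπ/2n)]² with density 4/((1+u²)(1+w²)) (u = tan(θ/2); value
(mπ/n)²) satisfies n²·[square] − m²·[π]·[π] ∈ relations. Moves: the Möbius rotation u ↦
(u+c)/(1−cu), c = tan(π/2n) (algebraic, preserves 2du/(1+u²)), and its square tile [0,tan(mπ/2n)]²
by m² and [0,∞)² by n² translates of the unit square [0,tan(π/2n)]² (rule 2 + 1a); [0,∞)² with this
density ∼ [π]·[π] by KZ's own π-chain run in each factor (u ↦ −u folding, x = (u²−1)/(u²+1),
Newton–Leibniz in y). Engine (iii)–(iv) of the card; shares the 1-dim Möbius lemmas with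
LowDimension item 0405. [difficulty: M] [KontsevichZagier2001]
#9 KRSectorExists (support) — Construction (interface ≠ existence): there is a normal matrix n with
n nᵀ = G(T) — e.g. the Cholesky factor, entries real-algebraic (nested radicals in cos(kπ/18)) — and
an integrand-1 representation whose domain is the sector {v ∈ B⁴ : ⟨n_i, v⟩ ≥ 0}: ℚ-semialgebraic
because real algebraic numbers are ℚ-definable (projection of {minpoly = 0, isolating box} by
tarski_seidenberg_real_holds), integrable because bounded. Makes cruxes 2 and 4 non-vacuous.
[difficulty: provable-now] [KolpakovRobins2019, BochnakCosteRoy1998]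

TWO-LAYER PLAN. KolpakovRobinsChain ⇐ FamilyTransport → SchlafliFlux → KolpakovRobinsChain (k = 2,
plus the already-filed support
RationalAngleSquares): FamilyTransport = after one rule-2 move sending cone(T(τ)) ∩ B⁴ to a fixed
sector Q with algebraic
integrand F(μ,τ) (vertex matrix A(τ) and radial rescaling; τ an algebraic parameter of the circle,
e.g. tan(t/4)),
[D_T] − [D_T(π/6)] ∼ [Q × [τ₀,τ₁], −∂_τF] by ONE rule-3 move in the parameter direction ([D_T(π/6)]
≡ 0, null domain);
SchlafliFlux = that 5-dim representation ∼ ⅛ Σ_e m_e E_e with E_e the 2-dim edge-sector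
representations ∫∫ ℓ_e dθ_e
(divergence theorem on Q facet by facet = fibre Newton–Leibniz with POLYNOMIAL primitives + rule 2;
Milnor's proof of
Schläfli made semialgebraic; multiplicities m = (2,2,1,1); dℓ = ±dθ on the family turns each E_e
into ± a difference of
two squares of angles in (π/36)ℤ). KolpakovRobinsPair ⇐ DirectSplice (both sides reduced to
2·36²-multiples of the unit
square without dividing) → KolpakovRobinsPair. SphericalVolumeSector ⇐ RationalKRSubsector (all 59 +
42 KR instances by
the same engine) → LambertPairs (KR Q4.2/4.3) → SphericalVolumeSector only as evidence; its general
case needs a new idea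
(no mechanism off the Pythagorean locus). Nothing here is filed now.

KILL CRITERIA. KolpakovRobinsChain, KolpakovRobinsPair and SphericalVolumeSector are INSTANCES of
Conjecture 1 (values verified: KR
Prop 2.1, |I₂(9)²| = 324, Monte Carlo 1/324 ± 1.3 % for both sectors): a refutation of any of them —
necessarily by an
additive invariant of the four move sets separating the two sides — refutes the SUMMIT; close
`refuted:<Decl>` and hand the
invariant to route Neg (it would be a spherical scissors-type invariant surviving curved Jacobians
and dimension change,
unknown today). If instead the family chain cannot be BUILT (∂_τF non-integrable at the corank-2 end
for every
normalisation, and the t = 0 member (π/4,π/4,2π/3,2π/3), vol π²/144, inaccessible): pivot the anchor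
(KR two-parameter
families through T; concatenated families; Lambert cubes) by `--restate`, else close `exhausted` —
Conjecture 1's
prediction stands, mechanism lost. VolumeForm proved elsewhere (ScissorsTransport's
StableSetTransport) moots the route;
a proof of SphericalVolumeSector by a general method moots cruxes 2 and 4.

NOT DECOMPOSED YET. The normalising change of variables and its integrability lemma at t → π/6; the
in-rules Schläfli flux computation
(facet parametrisations, the ½ and ¼ as honest multiplicities, not divisions); the 1-dim Möbius/arc
lemmas (shared with
LowDimension 0405); the other ten Coxeter tetrahedra and the remaining 171 KR rational tetrahedra
and 8 two-parameter
families (prover-level `--supports SphericalVolumeSector` calibrations); the Lambert-cube pairs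
31π²/576, 17π²/360; an
explicit Dehn-NONZERO equal-volume algebraic pair (none written down — finding one is a task);
torsion-freeness of
FormalRep⧸relations as a standalone statement (belongs to the PiCancellation / integral-domain
circle of route
AyoubSpecialisation); the stereographic (ℝ³, density 8/(1+|x|²)³) model of the card — replaced here
by the radial B⁴ model,
equivalent by one rule-2 move and not needed.

CHEAPEST FALSIFIER. (i) DONE: does KR family 11 reach a degenerate member with rational-π parameter
inside the closure of the Gram-positive
region? Yes — (p,q,r,s)(t) = (π/4+t/2, π/4−t/2, 2π/3+t, 2π/3−t), G₃, G₄ > 0 on [0, π/6), G₃ = G₄ = 0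
and Vol = π²/144 − t²/4
= 0 at t = π/6, no Coxeter member (2π/3 + t > π/2); Monte Carlo confirms vol₄(cone(T)∩B⁴) =
vol₄(B⁴)/324 for T and T′
(mc_check.py, 1.85·10⁶ ball points). (ii) NEXT, one page or one kit job: with the explicit vertex
matrix A(t) of T(t),
F(μ,t) = |det A(t)|/(μᵀA(t)ᵀA(t)μ)² on the fixed orthant sector Q — is ∫_Q ∫_{π/18}^{π/6} |∂_t F| dt
dμ finite (Gram
eigenvalues vanish like (0.0003, 0.0008) at t = π/6 − 0.001, volume linearly)? Divergence for this
and for the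
barycentric normalisation forces the re-anchoring pivot. (iii) Lookup: is T(0) = (π/4, π/4, 2π/3,
2π/3) (vol π²/144 =
4·vol F₄-orthoscheme = 2·vol I₂(12)²-chamber) Coxeter-decomposable (Felikson's lists)? If yes, a
non-degenerate second
anchor exists and (ii) is moot.

NUMBERS. Vol₃ T = Vol₃ T′ = π²/162 (KR Prop. 2.1; |I₂(9)×I₂(9)| = 324, 2π²/324); vol₄ B⁴ = π²/2;
vol₄ D_T = vol₄ D_T′ = π²/648, so
648·[D_T] ↔ [π]·[π] and 324·[D_T′] ↔ [B⁴] are the integral forms; MC: 0.9973 ± 0.013 and 0.9907 ±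
0.013 of 1/324.
Family 11: Vol(t) = π²/144 − t²/4, dVol/dt = ½(p′·2p + q′·2q + (π−r)r′ + (π−s)s′) = −t/2 (Schläfli
with KMP edge lengths
(ℓ_p,ℓ_q,ℓ_r,ℓ_s) = (p,q,π−r,π−s), multiplicities (2,2,1,1)); Gram minors at T: (1, 0.587, 0.220,
0.0483); eigenvalues at
t = π/6: (0, 0, 1.134, 2.866). Angles/edges at t₀ = π/18: (10,8,10,14)·π/36, at t₁ = π/6:
(12,6,6,18)·π/36;
p²+q²−((π−r)²+(π−s)²)/2 = π²/81 at t₀ and 0 at t₁; unit square value (π/36)², 648·vol₄(D_T) = π² =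
1296·(π/36)². KR census:
59 sporadic + 34 one- + 8 two-parameter families (172 sporadic solutions before merging); Lambert
cubes L₁ = 31π²/576,
L₂ = 17π²/360 vs T₁ = (π/2,π/2,π/2,31π/144), T₂ = (π/2,π/2,π/2,17π/90). Items at open: 9 (1 target,
3 cruxes, 4 support,
1 assembly).

DEFINITION REQUESTS. None: every statement elaborates over KZCalculus.lean alone (Sketch.lean rc 0;
[π]·[π] is inlined as the bidisc so no import beyond the Statement is needed). No named fact is
needed as a
hypothesis — the chain of crux 2 PROVES KR's volume value through soundness; Schläfli's formula
enters only as the proof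
plan. (Optional later: a cite fact "KolpakovRobins2019 Prop. 2.1" if a prover wants the value
equality of crux 4 without
crux 2.)

Novelty: Searches (2026-08-15): `lit search --source zbmath` "spherical tetrahedra rational volume" (5:
KolpakovRobins2019,
Leppmeier doi:10.4171/em/405, Costantino, Thurston, Tillmann), "Schläfli differential formula volume
spherical simplex" (4:
Debrunner 1990 doi:10.1007/bf00183080, Aomoto 1992, Ratcliffe, Zhang2017), "scissors congruence
spherical Dupont Sah" (1 +
DupontSah1982), "Dupont Sah scissors congruences II" (2), "Cheeger Simons differential characters"
(CheegerSimons1985),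
"Kontsevich Zagier periods scissors congruence" (0), "Schläfli orthoscheme volume rational Coxeter
conjecture" (0);
`--source crossref` "Kolpakov Robins …" (KolpakovMednykhPashkevich2011); `lit galaxy search --star
all` "spherical
tetrahedra Schläfli volume rational" (0), "rational simplex conjecture" (0), "Schläfli differential"
(6 pdf: Zhang
math/0702601, Schlenker–Souam math/0611499, Luo–Schlenker, Springborn); `lit frontier
KontsevichZagierPeriods --since 2020`
(30, none on volumes/scissors); `lit bridges --cross any` (30, none); `lit read arXiv:1811.06598`
pp. 1–13 (Thm 1.3/1.5,
Prop 2.1/2.2, Thm 2.3, §3 proof, Questions 3.1/4.2/4.3/5.1; appendix tables absent from the text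
layer — family 11
reconstructed and verified numerically) and arXiv:math/0702601 p. 9 (Schläfli (4.1)); the local FTS
daemon was down
(connection reset) and OpenAlex/arXiv/S2 rate-limited during the session; all 123 cards + 7 route
files of the sub
(spherical geometry only in this card; ScissorsTransport = curvature-free transpo  [refs: 10.4171/em/405, 10.1007/bf00183080, 1811.06598, math/0702601, doi:10.4171/em/405, doi:10.1007/bf00183080, KolpakovRobins2019, Zhang2017, DupontSah1982, CheegerSimons1985, KolpakovMednykhPashkevich2011, Coxeter1934]

Barriers (technique_class: spherical-scissors-sector, schlafli-family-chain): - technique_class: spherical-scissors-sector, schlafli-family-chain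
- Literature.Barriers.KontsevichZagierPeriods.noSemialgebraicPrimitive_inv_sub_two: evaded — the
only rule-3 uses are the parameter-direction move whose primitive is the transported integrand
F(μ,τ) itself (semialgebraic by construction) and fibre Stokes with polynomial primitives for the
flux forms; arc lengths/angles are never primitives: they stay 1-dim integrals and are paired into
SQUARES by a symmetry move (RationalAngleSquares), so no arctan, log or dilogarithm primitive is
ever required.
- Literature.Barriers.KontsevichZagierPeriods.cressonViuSos_prop_3_2: not engaged — every chain
dissects (reflection-group tilings, Möbius tilings) and changes dimension (4 → 5 → 2 → 4);
KolpakovRobinsPair asserts an equivalence, never a global semialgebraic homeomorphism D_T → D_T′.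
- Literature.Barriers.KontsevichZagierPeriods.kzConjecture_implies_oddZetaAlgIndep: not engaged by
cruxes 2–4 and the support items (all values in ℚπ², no irrationality asserted or used); engaged
only by the frame X = VolumeForm, which is summit-equivalent — conceded, the bet lives in the
sector.
- Literature.Barriers.KontsevichZagierPeriods.kzConjecture_implies_twoPiI_log_algIndep: same — not
engaged below the target.
- Literature.Barriers.KontsevichZagierPeriods.kzConjecture_implies_ellipticPeriods_algIndep: same —
not engaged below the target.
- Literature.Barriers.KontsevichZagierPeriods.not_complete_of_undecidable: consistent — on th

History (route lifecycle, newest last):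
- 2026-08-16T04:09:39Z · AUTO-CRUX (backfill): VolumeForm — hypotheses of the deciding theorem that nothing in the route derives are cruxes (operator:999:1085951)
- 2026-08-24T15:53:21Z · DORMANT — reconciler: no traction for 6.9 d (last activity item-evidence-added at 2026-08-17T18:17:02Z); parked, not closed — `ledger route dormant route-KontsevichZagier (operator:999:2191654)
- 2026-08-31T08:40:06Z · REACTIVATED (open) — reconciler: reactivated — activity statement-checked at 2026-08-31T07:27:55Z after parking at 2026-08-24T15:53:21Z (operator:999:705301)

sub-problem: KontsevichZagierPeriods · status: open · opened planner-plancard-KontsevichZagierPeriods-Kont-9fb23588-0 2026-08-15T11:24:39Z · rev 4 · ledger route-KontsevichZagierPeriods-SphericalSchlafli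
GENERATED by the gate from the ledger (D-0016/17). Provers cite these decls: `theorem foo : Summit.KontsevichZagierPeriods.KontsevichZagierPeriods.Theses.SphericalSchlafli.<Decl> := …` in Summits/KontsevichZagierPeriods/KontsevichZagierPeriods/Theorems/<Name>.lean.
-/

namespace Summit.KontsevichZagierPeriods.KontsevichZagierPeriods.Theses.SphericalSchlafli

open scoped BigOperators Topology Manifold Classical MeasureTheory ProbabilityTheory Matrix InnerProductSpace ComplexConjugate ContinuousMap
open Filter Set Function TopologicalSpace MeasureTheory

attribute [summit_statement] _root_.KontsevichZagierPeriods

open Literature Periods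

/-- item stmt-KontsevichZagierPeriods-3814 · crux (kind.auto-crux: conjecture-grade) · rank 0 · open · by planner
why it might fail: Summit-equivalent (Assembly; integrand 1 is rational), so every strength barrier applies: false iff an additive invariant of the four move sets refines volume on ℚ-semialgebraic sets.
sources: KontsevichZagier2001, ViuSos2021, CressonViusos2022
[target] X — two integrand-1 integral representations of one dimension N with equal value are
KZ-equivalent (volume is the only KZ-invariant of finite-volume ℚ-semialgebraic sets);
summit-equivalent frame of the route, attacked here on the spherical sector. -/
@[route_item "route-KontsevichZagierPeriods-SphericalSchlafli", crux]
def VolumeForm : Prop :=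
  ∀ ⦃N : ℕ⦄ (r r' : Literature.NumberTheory.Transcendental.KZ.IntegralRep N), (∀ x ∈ r.domain, r.integrand x = 1) → (∀ x ∈ r'.domain, r'.integrand x = 1) → r.value = r'.value → Literature.NumberTheory.Transcendental.KZ.Equivalent r r'

/-- item stmt-KontsevichZagierPeriods-3815 · crux · rank 2 · open · by planner
why it might fail: Anchor t=π/6 is a corank-2 degeneration (Gram rank 2): after the rule-2 map normalising cone(T(t))∩B⁴ to a fixed sector, ∂ₜ of the transported integrand may fail absolute integrability there; and the chain may only deliver k·(648[D_T]−[π²]) ∈ relations (division is not a move).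
sources: KolpakovRobins2019, KolpakovMednykhPashkevich2011, KolpakovMednykhPashkevich2013, Zhang2017, KontsevichZagier2001
[crux] For the Kolpakov–Robins tetrahedron T — ℤ₂-symmetric, dihedral angles (p,q,r,s) = (5π/18,
2π/9, 13π/18, 11π/18) in the pattern of their Gram matrix (4) (G_ij = −cos θ_ij for inward unit
normals), volume π²/162, not decomposable into Coxeter tetrahedra (KR Thm 1.5) — every integrand-1
representation r whose domain is the solid sector {v ∈ B⁴ : ⟨n_i, v⟩ ≥ 0} for normals n with n nᵀ =
G(T) (value π²/648, Monte-Carlo-checked 1/324 of B⁴) satisfies 648·[r] − [π]·[π] ∈ KZ.relations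
([π]·[π] written as the bidisc representation [{v₀²+v₁² ≤ 1, v₂²+v₃² ≤ 1}, 1] ⊂ ℝ⁴, value π²).
Intended proof: Schläfli inside the rules along family 11 from the degenerate member t = π/6 (value
0, null domain ⇒ relation) to t = π/18, then RationalAngleSquares (card items S2 (i)–(iv)). [deps:
RationalAngleSquares, KRSectorExists] [difficulty: L] -/
@[route_item "route-KontsevichZagierPeriods-SphericalSchlafli"]
def KolpakovRobinsChain : Prop :=
  ∀ (n : Fin 4 → Fin 4 → ℝ), (∀ i j, ∑ k, n i k * n j k = (!![1, -Real.cos (13 * Real.pi / 18), -Real.cos (5 * Real.pi / 18), -Real.cos (2 * Real.pi / 9); -Real.cos (13 * Real.pi / 18), 1, -Real.cos (2 * Real.pi / 9), -Real.cos (5 * Real.pi / 18); -Real.cos (5 * Real.pi / 18), -Real.cos (2 * Real.pi / 9), 1, -Real.cos (11 * Real.pi / 18); -Real.cos (2 * Real.pi / 9), -Real.cos (5 * Real.pi / 18), -Real.cos (11 * Real.pi / 18), 1] : Matrix (Fin 4) (Fin 4) ℝ) i j) → ∀ (r : Literature.NumberTheory.Transcendental.KZ.IntegralRep 4), r.domain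 = {v | (∀ i, 0 ≤ ∑ k, n i k * v k) ∧ ∑ j, v j ^ 2 ≤ 1} → (∀ v ∈ r.domain, r.integrand v = 1) → ∀ (p : Literature.NumberTheory.Transcendental.KZ.IntegralRep 4), p.domain = {v | v 0 ^ 2 + v 1 ^ 2 ≤ 1 ∧ v 2 ^ 2 + v 3 ^ 2 ≤ 1} → (∀ v ∈ p.domain, p.integrand v = 1) → (648 : ℕ) • Literature.NumberTheory.Transcendental.KZ.of r - Literature.NumberTheory.Transcendental.KZ.of p ∈ Literature.NumberTheory.Transcendental.KZ.relations

/-- item stmt-KontsevichZagierPeriods-3816 · crux · rank 3 · open · by planner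
why it might fail: Only Conjecture 1 predicts it: off the Pythagorean families equal volumes are coincidences among Re Li₂-combinations (Murakami–Yano type formulas) with no chain-producing mechanism, and an additive move-invariant refining volume (e.g. from the Cheeger–Simons class) would refute it and the summit.
sources: KolpakovRobins2019, DupontSah1982, CheegerSimons1985, Goncharov1999, KontsevichZagier2001
[crux] X on the spherical sector: two integrand-1 representations in dimension 4 whose domains are
finite unions of closed polyhedral-cone sectors {v : ⟨n_i, v⟩ ≥ 0, i < 4} of the closed unit ball B⁴
(spherical polytopes read radially; algebraicity of the normals is forced by ℚ-semialgebraicity of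
the domain) and whose values agree are KZ-equivalent — "volume is the only KZ-invariant of spherical
polytopes": Hilbert's third problem in S³ inside the calculus, where the Dehn invariant is NO
obstruction. Contains every Coxeter tiling, every equal-volume pair among KR's 59 sporadic + 42
families of rational tetrahedra, the Lambert-cube pairs of KR Questions 4.2/4.3, KR Question 5.1 at
n = 3, and Dehn-nonzero equal-volume pairs. [deps: KolpakovRobinsChain] [difficulty: open-problem] -/
@[route_item "route-KontsevichZagierPeriods-SphericalSchlafli"]
def SphericalVolumeSector : Prop :=
  ∀ (r r' : Literature.NumberTheory.Transcendental.KZ.IntegralRep 4), (∃ S : Finset (Fin 4 → Fin 4 → ℝ), r.domain = {v | (∃ n ∈ S, ∀ i, 0 ≤ ∑ k, n i k * v k) ∧ ∑ j, v j ^ 2 ≤ 1}) → (∀ v ∈ r.domain, r.integrand v = 1) → (∃ S : Finset (Fin 4 → Fin 4 → ℝ), r'.domain = {v | (∃ n ∈ S, ∀ i, 0 ≤ ∑ k, n i k * v k) ∧ ∑ j, v j ^ 2 ≤ 1}) → (∀ v ∈ r'.domain, r'.integrand v = 1) → r.value = r'.value → Literature.NumberTheory.Transcendental.KZ.Equivalent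 r r'

/-- item stmt-KontsevichZagierPeriods-3817 · crux · rank 4 · open · by planner
why it might fail: Cruxes 2 + CoxeterChamberTiling + BallCalibration give only 648·([D_T]−[D_T′]) ∈ relations; concluding needs torsion-freeness of FormalRep⧸relations (open, cf. KZ.PiCancellation) or a division-free direct splice of the family chain with the I₂(9)² tiling.
sources: KolpakovRobins2019, Coxeter1934, DupontSah1982
[crux] The Kolpakov–Robins pair is KZ-equivalent: [cone(T) ∩ B⁴, 1] ∼ [cone(T′) ∩ B⁴, 1] for T as in
crux 2 and T′ the Coxeter tetrahedron I₂(9)×I₂(9) (dihedral angles π/9, π/9, π/2, π/2, π/2, π/2; |W|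
= 324; explicit chamber 0 ≤ θ₁ ≤ π/9, 0 ≤ θ₂ ≤ π/9 in the two coordinate planes) — equal volumes
π²/162, equal (zero) Dehn invariants, scissors congruence unknown (KR Question 3.1, also 5.1 at n =
3): the headline "rules ⊋ spherical scissors congruence" instance. [deps: KolpakovRobinsChain,
CoxeterChamberTiling, BallCalibration] [difficulty: L] -/
@[route_item "route-KontsevichZagierPeriods-SphericalSchlafli"]
def KolpakovRobinsPair : Prop :=
  ∀ (n : Fin 4 → Fin 4 → ℝ), (∀ i j, ∑ k, n i k * n j k = (!![1, -Real.cos (13 * Real.pi / 18), -Real.cos (5 * Real.pi / 18), -Real.cos (2 * Real.pi / 9); -Real.cos (13 * Real.pi / 18), 1, -Real.cos (2 * Real.pi / 9), -Real.cos (5 * Real.pi / 18); -Real.cos (5 * Real.pi / 18), -Real.cos (2 * Real.pi / 9), 1, -Real.cos (11 * Real.pi / 18); -Real.cos (2 * Real.pi / 9), -Real.cos (5 * Real.pi / 18), -Real.cos (11 * Real.pi / 18), 1] : Matrix (Fin 4) (Fin 4) ℝ) i j) → ∀ (r r' : Literature.NumberTheory.Transcendental.KZ.IntegralRep 4), r.domain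 = {v | (∀ i, 0 ≤ ∑ k, n i k * v k) ∧ ∑ j, v j ^ 2 ≤ 1} → (∀ v ∈ r.domain, r.integrand v = 1) → r'.domain = {v | 0 ≤ v 1 ∧ 0 ≤ Real.sin (Real.pi / 9) * v 0 - Real.cos (Real.pi / 9) * v 1 ∧ 0 ≤ v 3 ∧ 0 ≤ Real.sin (Real.pi / 9) * v 2 - Real.cos (Real.pi / 9) * v 3 ∧ ∑ j, v j ^ 2 ≤ 1} → (∀ v ∈ r'.domain, r'.integrand v = 1) → Literature.NumberTheory.Transcendental.KZ.Equivalent r r'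

/-- item stmt-KontsevichZagierPeriods-17978 · crux · rank 5 · open · by planner
why it might fail: Asked BY MOVES: false iff some bounded ℚ-semialgebraic solid needs rectilinearisation charts that are only Nash-on-a-cover, which rule (2) (injective ℚ-semialgebraic differentiable maps on open pieces) cannot chain; no instance known — the ζ(2), ζ(3) corners resolve by one rational blow-up each.
sources: Ayoub2014, HuberMullerStach2017, Hironaka1964, BierstoneMilman1988, Parusinski1994, KontsevichZagier2001
[crux] CUBE RESOLUTION — GEOMETRY INSIDE THE RULES (piece X₁ of the BC2-redirect split of the rank-0
target ReductionRigidity, crux-strategist re-audit r1, 2026-08-17): every integral representation of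
the H21 calculus is congruent modulo KZ.relations to a ℤ-combination of TAME CUBE classes [[0,1]ⁿ,
f], f real analytic on a neighbourhood of the closed cube — Ayoub's compact presentation (Ayoub2014
Def 9–10, Prop 11; HMS 2017 Thm 12.2.1 at the level of VALUES) realised by MOVES: compactification,
cell decomposition and Nash charts of cells (rules 1a, 2), then embedded resolution /
rectilinearisation of the boundary singularities of the Nash integrands by blow-up charts and power
substitutions t = τᴺ as rule-(2) instances on open pieces, absolute integrability forcing the
exponents ≥ 0 after τᴺ. Transcendence-free, Hironaka strength, XL. Byte-identical up to unfolding
(cube = {x | ∀ i, 0 ≤ x i ∧ x i ≤ 1} = KZ.cube = ReducedPeriodRing.unitCube, span =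
ReducedPeriodRing.cubicalSpan) with the registered stubs stub_cubeResolution S1 of crux stmt-10813
(FurushoPentagon.SectorToKernel) and S1b of crux stmt-3929 (ReducedPeriodRing) — ONE statement
staffed hub-wide; implied verbatim by item -/
@[route_item "route-KontsevichZagierPeriods-SphericalSchlafli"]
def CubeResolution : Prop :=
  ∀ (N : ℕ) (u : Literature.NumberTheory.Transcendental.KZ.IntegralRep N), ∃ c ∈ AddSubgroup.closure {d : Literature.NumberTheory.Transcendental.KZ.FormalRep | ∃ (n : ℕ) (r : Literature.NumberTheory.Transcendental.KZ.IntegralRep n), r.domain = {x : Fin n → ℝ | ∀ i, 0 ≤ x i ∧ x i ≤ 1} ∧ AnalyticOnNhd ℝ r.integrand {x : Fin n → ℝ | ∀ i, 0 ≤ x i ∧ x i ≤ 1} ∧ d = Literature.NumberTheory.Transcendental.KZ.of r}, Literature.NumberTheory.Transcendental.KZ.of u - c ∈ Literature.NumberTheory.Transcendental.KZ.relations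

/-- item stmt-KontsevichZagierPeriods-18116 · crux · rank 6 · open · by planner
why it might fail: Printed open, GPC strength: false iff a vanishing ℚ-algebraic cube period has no type-(a) certificate in ANY number of auxiliary variables; with the variable count bounded it IS false (Ayoub2015 Rem 1.2; tree barrier kernelElt_not_stokes_one_variable).
sources: Ayoub2015, Fresan2024, Ayoub2014, AyoubRelKZRevisited, HuberWustholz2022
[crux] AYOUB'S EFFECTIVE CUBE CONJECTURE at k = ℚ (piece X₂ of the BC2-redirect split of
ReductionRigidity, crux-strategist r1; PRINTED: J. Ayoub, Ann. of Math. 181 (2015) Conj. 1.1 = J.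
Fresán, X-UPS 2024 Conj. 3.5): the kernel of ∫_{[0,1]^∞} on 𝒪_{ℚ-alg}(𝔻̄^∞) — power series in
finitely many variables, polyradius of convergence > 1, algebraic over ℚ(z) (AyoubRel.Oan
(Rat.castHom ℂ), AyoubRel.intC) — is the ℚ-span (AyoubRel.kSpan) of the type-(a) elements ∂G/∂zᵢ −
G|_{zᵢ=1} + G|_{zᵢ=0} (AyoubRel.relAC i G). Conjecture 1's TRANSCENDENCE content in Ayoub's LINEAR
presentation: one filtered function space, n commuting operators ∂ᵢ and the face restrictions, no
domains, no semialgebraic geometry, no rule (2); ⊇ is the tree theorem AyoubRel.intC_relAC_eq_zero;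
the RELATIVE version is a THEOREM (AyoubRelKZRevisited Thm 1.11, tree fact
ayoub_integration_injective_localized: injective after inverting 2πi); the variable count cannot be
bounded (Ayoub Rem 1.2; tree: kernelElt_not_stokes_one_variable). Verbatim the registered stub
stub_ayoubEffectiveCubeKernel S6 of crux stmt-10813; ⇔ the summit-side @[conjecture] leaf
TypeAGenerationConjecture (AyoubRel.typeAGeneration_forall_iff_rat, algeb -/
@[route_item "route-KontsevichZagierPeriods-SphericalSchlafli"]
def AyoubEffectiveCubeKernel : Prop :=
  ∀ F ∈ Literature.NumberTheory.Transcendental.AyoubRel.Oan (Rat.castHom ℂ), Literature.NumberTheory.Transcendental.AyoubRel.intC F = 0 → F ∈ Literature.NumberTheory.Transcendental.AyoubRel.kSpan (Rat.castHom ℂ) {x : Literature.NumberTheory.Transcendental.AyoubRel.CSeries | ∃ G ∈ Literature.NumberTheory.Transcendental.AyoubRel.Oan (Rat.castHom ℂ), ∃ i : ℕ, x = Literature.NumberTheory.Transcendental.AyoubRel.relAC i G}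

/-- item stmt-KontsevichZagierPeriods-18450 · support · rank 9 · closed · proved by Summit.KontsevichZagierPeriods.SphericalSchlafli.VolumeFormOfCubes.volumeFormOfCubes_proof @ cab540113996 (prover) · by planner
sources: Ayoub2015, Ayoub2014, KontsevichZagier2001
[support] SPLIT GLUE of the frame (crux-strategist r1, RESTATED re-audit: BC2 REDIRECT of VolumeForm
along Ayoub's normal-form seam): CubeResolution → AyoubEffectiveCubeKernel → VolumeForm. PROVED
sorry-free in Cruxes/VolumeForm/SplitGlue.lean (`VolumeForm_of_cubes`, rc 0, axioms standard;
evidence on stmt-3814): resolve both bodies (X₁) → the difference is a resolved combination with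
eval 0 → MERGE to one tame cube class (ReducedPeriodRing.stub_cubeMerge) → Ayoub-ADMISSIBLE power
series (stub_admissibleOfTame) → soundness ∫ = 0 → REAL STOKES FORM from X₂ (stub_realStokesForm) →
ℚ-semialgebraic primitives (stub_semialgebraicOfAlgebraic) → pad + calibrate each Stokes element as
ONE Newton–Leibniz move (stub_stokesSpanCalibration) → relation; every step a landed theorem. To
land: Theorems/SphericalSchlafliVolumeFormOfCubes.lean, `theorem volumeFormOfCubes_proof :
VolumeFormOfCubes := fun h1 h6 => VolumeForm_of_cubes h1 h6` (copy SplitGlue.lean). The formal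
`route edit --split VolumeForm --into CubeResolution AyoubEffectiveCubeKernel --glue-by …` attaches
to these items on a final cycle. [difficulty: provable-now] -/
@[route_item "route-KontsevichZagierPeriods-SphericalSchlafli"]
def VolumeFormOfCubes : Prop :=
  CubeResolution → AyoubEffectiveCubeKernel → VolumeForm

-- `VolumeFormOfCubes` holds: proved by `Summit.KontsevichZagierPeriods.SphericalSchlafli.VolumeFormOfCubes.volumeFormOfCubes_proof` @ cab540113996 (its module imports this route file, so no `_holds` link can be stated here).

/-- item stmt-KontsevichZagierPeriods-3818 · support · rank 9 · closed · proved by Summit.KontsevichZagierPeriods.SphericalSchlafli.coxeterChamberTiling_proof @ 86d77462bdf8 (prover) · by planner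
sources: Coxeter1934, KolpakovRobins2019
[support] 324·[D_T′] − [B⁴] ∈ relations for the I₂(9)×I₂(9) chamber sector D_T′ = {v ∈ B⁴ : 0 ≤
θ(v₀,v₁) ≤ π/9, 0 ≤ θ(v₂,v₃) ≤ π/9}: its 324 images under I₂(9)×I₂(9) ⊂ O(2)×O(2) (entries
±cos(kπ/9), ±sin(kπ/9), algebraic, |det| = 1 ⇒ one rule-2 move each; images ℚ-semialgebraic via
tarski_seidenberg_real_holds) cover B⁴ with null overlaps (323 rule-1a moves). Calibration S1 of the
card; the other ten Coxeter tetrahedra are prover-level variants. [difficulty: M] -/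
@[route_item "route-KontsevichZagierPeriods-SphericalSchlafli"]
def CoxeterChamberTiling : Prop :=
  ∀ (r b : Literature.NumberTheory.Transcendental.KZ.IntegralRep 4), r.domain = {v | 0 ≤ v 1 ∧ 0 ≤ Real.sin (Real.pi / 9) * v 0 - Real.cos (Real.pi / 9) * v 1 ∧ 0 ≤ v 3 ∧ 0 ≤ Real.sin (Real.pi / 9) * v 2 - Real.cos (Real.pi / 9) * v 3 ∧ ∑ j, v j ^ 2 ≤ 1} → (∀ v ∈ r.domain, r.integrand v = 1) → b.domain = {v | ∑ j, v j ^ 2 ≤ 1} → (∀ v ∈ b.domain, b.integrand v = 1) → (324 : ℕ) • Literature.NumberTheory.Transcendental.KZ.of r - Literature.NumberTheory.Transcendental.KZ.of b ∈ Literature.NumberTheory.Transcendental.KZ.relations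

-- `CoxeterChamberTiling` holds: proved by `Summit.KontsevichZagierPeriods.SphericalSchlafli.coxeterChamberTiling_proof` @ 86d77462bdf8 (its module imports this route file, so no `_holds` link can be stated here).

/-- item stmt-KontsevichZagierPeriods-3819 · support · rank 9 · closed · proved by Summit.KontsevichZagierPeriods.EulerFormChain.ballCalibration_proof @ 9b5abc8e249b (prover) · by planner
sources: KontsevichZagier2001
[support] 2·[B⁴] − [π]·[π] ∈ relations (vol₄ B⁴ = π²/2; [π]·[π] = the bidisc [D²×D², 1] ⊂ ℝ⁴ (value
π², = KZ.piRep.prod KZ.piRep up to the definitional integrand)): the fibrewise scaling (u,w) ↦ (u,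
√(1−|u|²)·w) maps D²×D² onto B⁴ with Jacobian 1−|u|² (rule 2 on the open part, null boundary by 1a),
integrand additivity splits 1−|u|², and [D²×D², |u|²] ∼ [half-disc sector form] by the
radial-squaring/half-angle map u ↦ |u|·(half-angle of u) (rule 2, Jacobian |u|²·const) plus a
rotation; no division needed. [difficulty: M] -/
@[route_item "route-KontsevichZagierPeriods-SphericalSchlafli"]
def BallCalibration : Prop :=
  ∀ (b : Literature.NumberTheory.Transcendental.KZ.IntegralRep 4), b.domain = {v | ∑ j, v j ^ 2 ≤ 1} → (∀ v ∈ b.domain, b.integrand v = 1) → ∀ (p : Literature.NumberTheory.Transcendental.KZ.IntegralRep 4), p.domain = {v | v 0 ^ 2 + v 1 ^ 2 ≤ 1 ∧ v 2 ^ 2 + v 3 ^ 2 ≤ 1} → (∀ v ∈ p.domain, p.integrand v = 1) → (2 : ℕ) • Literature.NumberTheory.Transcendental.KZ.of b - Literature.NumberTheory.Transcendental.KZ.of p ∈ Literature.NumberTheory.Transcendental.KZ.relations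

/-- `BallCalibration` holds: proved by `Summit.KontsevichZagierPeriods.EulerFormChain.ballCalibration_proof` @ 9b5abc8e249b. -/
theorem BallCalibration_holds : BallCalibration := _root_.Summit.KontsevichZagierPeriods.EulerFormChain.ballCalibration_proof

/-- item stmt-KontsevichZagierPeriods-3820 · support · rank 9 · closed · proved by Summit.KontsevichZagierPeriods.SphericalSchlafli.rationalAngleSquares_proof @ 6fbd88fb48d2 (prover) · by planner
sources: KontsevichZagier2001
[support] Squares of rational angles are accessible multiples of [π]·[π]: for 0 < m < n the square
[0, tan(mπ/2n)]² with density 4/((1+u²)(1+w²)) (u = tan(θ/2); value (mπ/n)²) satisfies n²·[square] −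
m²·[π]·[π] ∈ relations. Moves: the Möbius rotation u ↦ (u+c)/(1−cu), c = tan(π/2n) (algebraic,
preserves 2du/(1+u²)), and its square tile [0,tan(mπ/2n)]² by m² and [0,∞)² by n² translates of the
unit square [0,tan(π/2n)]² (rule 2 + 1a); [0,∞)² with this density ∼ [π]·[π] by KZ's own π-chain run
in each factor (u ↦ −u folding, x = (u²−1)/(u²+1), Newton–Leibniz in y). Engine (iii)–(iv) of the
card; shares the 1-dim Möbius lemmas with LowDimension item 0405. [difficulty: M] -/
@[route_item "route-KontsevichZagierPeriods-SphericalSchlafli"]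
def RationalAngleSquares : Prop :=
  ∀ (m n : ℕ), 0 < m → m < n → ∀ (a : Literature.NumberTheory.Transcendental.KZ.IntegralRep 2), a.domain = {x | 0 ≤ x 0 ∧ x 0 ≤ Real.tan (m * Real.pi / (2 * n)) ∧ 0 ≤ x 1 ∧ x 1 ≤ Real.tan (m * Real.pi / (2 * n))} → (∀ x ∈ a.domain, a.integrand x = 4 / ((1 + x 0 ^ 2) * (1 + x 1 ^ 2))) → ∀ (p : Literature.NumberTheory.Transcendental.KZ.IntegralRep 4), p.domain = {v | v 0 ^ 2 + v 1 ^ 2 ≤ 1 ∧ v 2 ^ 2 + v 3 ^ 2 ≤ 1} → (∀ v ∈ p.domain, p.integrand v = 1) → (n ^ 2) • Literature.NumberTheory.Transcendental.KZ.of a - (m ^ 2) • Literature.NumberTheory.Transcendental.KZ.of p ∈ Literature.NumberTheory.Transcendental.KZ.relations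

-- `RationalAngleSquares` holds: proved by `Summit.KontsevichZagierPeriods.SphericalSchlafli.rationalAngleSquares_proof` @ 6fbd88fb48d2 (its module imports this route file, so no `_holds` link can be stated here).

/-- item stmt-KontsevichZagierPeriods-3821 · support · rank 9 · closed · proved by Summit.KontsevichZagierPeriods.SphericalSchlafli.krSectorExists_proof @ 01aedf893af5 (prover) · by planner
sources: KolpakovRobins2019, BochnakCosteRoy1998
[support] Construction (interface ≠ existence): there is a normal matrix n with n nᵀ = G(T) — e.g.
the Cholesky factor, entries real-algebraic (nested radicals in cos(kπ/18)) — and an integrand-1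
representation whose domain is the sector {v ∈ B⁴ : ⟨n_i, v⟩ ≥ 0}: ℚ-semialgebraic because real
algebraic numbers are ℚ-definable (projection of {minpoly = 0, isolating box} by
tarski_seidenberg_real_holds), integrable because bounded. Makes cruxes 2 and 4 non-vacuous.
[difficulty: provable-now] -/
@[route_item "route-KontsevichZagierPeriods-SphericalSchlafli"]
def KRSectorExists : Prop :=
  ∃ (n : Fin 4 → Fin 4 → ℝ), (∀ i j, ∑ k, n i k * n j k = (!![1, -Real.cos (13 * Real.pi / 18), -Real.cos (5 * Real.pi / 18), -Real.cos (2 * Real.pi / 9); -Real.cos (13 * Real.pi / 18), 1, -Real.cos (2 * Real.pi / 9), -Real.cos (5 * Real.pi / 18); -Real.cos (5 * Real.pi / 18), -Real.cos (2 * Real.pi / 9), 1, -Real.cos (11 * Real.pi / 18); -Real.cos (2 * Real.pi / 9), -Real.cos (5 * Real.pi / 18), -Real.cos (11 * Real.pi / 18), 1] : Matrix (Fin 4) (Fin 4) ℝ) i j) ∧ ∃ (r : Literature.NumberTheory.Transcendental.KZ.IntegralRep 4), r.domain = {v | (∀ i, 0 ≤ ∑ k, n i k * v k) ∧ ∑ j,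 v j ^ 2 ≤ 1} ∧ ∀ v ∈ r.domain, r.integrand v = 1

-- `KRSectorExists` holds: proved by `Summit.KontsevichZagierPeriods.SphericalSchlafli.krSectorExists_proof` @ 01aedf893af5 (its module imports this route file, so no `_holds` link can be stated here).

/-- item stmt-KontsevichZagierPeriods-3822 · assembly · rank 1 · closed · proved by Summit.KontsevichZagierPeriods.VolumeFormAssembly.symplecticScissors_assembly_proof (prover) · by planner
sources: ViuSos2021, KontsevichZagier2001
[assembly] VolumeForm → KontsevichZagierPeriods (difference of volumes + slabs + gluing +
soundness). -/
@[route_item "route-KontsevichZagierPeriods-SphericalSchlafli", crux]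
def Assembly : Prop :=
  VolumeForm → KontsevichZagierPeriods

-- `Assembly` holds: proved by `Summit.KontsevichZagierPeriods.VolumeFormAssembly.symplecticScissors_assembly_proof` (its module imports this route file, so no `_holds` link can be stated here).

/-! D-0027 §2.1 — DECIDING THEOREM (planner-authored via `route open/edit --closes-file`; by planner-rbadge-KontsevichZagierPeriods-Spheric-e16410d3-g2-0 2026-08-15T16:11:48Z):
its hypotheses are this route's items and its conclusion the sub-problem Statement (glue_lint), and it elaborates with this file. -/

@[closes "route-KontsevichZagierPeriods-SphericalSchlafli"] theorem closes : VolumeForm → Assembly → KontsevichZagierPeriods :=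
  fun hV hA => hA hV

end Summit.KontsevichZagierPeriods.KontsevichZagierPeriods.Theses.SphericalSchlafli
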